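import Summits.AnomalousDissipation.AnomalousDissipation.Theorems.MirrorVarietyTaylorGreenLoudGalerkinStatesLine
import Summits.AnomalousDissipation.AnomalousDissipation.Theses.MirrorVariety
import Literature.Analysis.FluidPDE.OnsagerBDSVGluing

/-!
# Sketch — crux-ideate round 1, ideator 3, crux `TaylorGreenLogLoudStates` (stmt-AnomalousDissipation-14586)

First-lemma signatures for the two idea cards of this seat (statements only, `def … : Prop`, plus
one kernel-checked composition).  Vocabulary reused from the landed tree files
`Theorems/TaylorGreenLoudGalerkinStates/Negative/LoadBearing.lean` (`tgForce`, `IsSteadyState`,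
`IsBandLimited`) and `Theorems/MirrorVarietyTaylorGreenLoudGalerkinStatesLine.lean` (`reflMat`, `actVec`,
`IsKSymm`), and the tree curl `Literature.Analysis.FluidPDE.BDSV.curl`.

* Card `chiral-carrier-maximal-work`: `tgForcePlus` (the positive-helical half `f₊` of `f_TG`),
  `HelicalHalfTestedEuler` (first lemma: `f₊` is an exact steady Euler flow in the tested sense, Beltrami
  with `curl f₊ = 2π√3 f₊`, `(f_TG, f₊) = ‖f₊‖² = 1/8`), `ChiralWorkSplit` (exact identity for admissible
  states), `NoBeltramiInMirrorClass`, the transfer target `ChiralLogLoud` and `crux_of_chiral`.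
* Card `glide-wired-edge-circuit`: `rotX`, `IsRxSymm`, `AxisPinning` (first lemma), `MirrorEdgesCarryNoFlux`.
-/

noncomputable section

set_option linter.dupNamespace false

open scoped InnerProductSpace Topology
open MeasureTheory Filter
open Literature.Analysis.FunctionSpaces Literature.Analysis.FunctionSpaces.Torus
open Literature.Analysis.FluidPDE

namespace Summit.AnomalousDissipation.AnomalousDissipation.Cruxes.TaylorGreenLogLoudStates.SketchIdeator3

open Summit.AnomalousDissipation.AnomalousDissipation.Theorems.TaylorGreenLoudGalerkinStates
open Summit.AnomalousDissipation.AnomalousDissipation.Theorems.TaylorGreenLoudGalerkinStates.Negative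

local notation "𝕋³" => UnitAddTorus (Fin 3)
local notation "ℝ³" => EuclideanSpace ℝ (Fin 3)

/-! ## Card A — chiral carrier -/

/-- The helical correction `h(x) = (−cosX sinY sinZ, −sinX cosY sinZ, 2 sinX sinY cosZ)` (`X = 2πx₀` etc.;
`(fourier 1 t).re = cos 2πt`, `.im = sin 2πt`). -/
def helCorr : 𝕋³ → ℝ³ := fun x =>
  !₂[-((fourier 1 (x 0) : ℂ).re * (fourier 1 (x 1) : ℂ).im * (fourier 1 (x 2) : ℂ).im),
    -((fourier 1 (x 0) : ℂ).im * (fourier 1 (x 1) : ℂ).re * (fourier 1 (x 2) : ℂ).im),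
    2 * ((fourier 1 (x 0) : ℂ).im * (fourier 1 (x 1) : ℂ).im * (fourier 1 (x 2) : ℂ).re)]

/-- The positive-helical half of the Taylor–Green force: `f₊ = ½ f_TG + (1/(2√3)) h`.  Claimed (card A,
First lemma): `curl f₊ = 2π√3 f₊`, so `f₊` (and `f₋ = f_TG − f₊`, `curl f₋ = −2π√3 f₋`) is an exact steady
Euler (Beltrami) flow on the single shell `|k|² = 3`. -/
def tgForcePlus : 𝕋³ → ℝ³ := fun x =>
  (1 / 2 : ℝ) • tgForce x + (1 / (2 * Real.sqrt 3)) • helCorr x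

/-- The negative-helical half `f₋ = f_TG − f₊`. -/
def tgForceMinus : 𝕋³ → ℝ³ := fun x => tgForce x - tgForcePlus x

/-- **First lemma of card A** (`HelicalHalfTestedEuler`): the helical half `f₊` is smooth, divergence-free,
mean-zero, Beltrami with constant `2π√3`, carries half the injection `(f_TG,f₊) = ‖f₊‖² = 1/8`, and is a
steady Euler flow in the TESTED sense of the crux bracket: `∫⟪f₊,(f₊·∇)a⟫ = 0` for every smooth
divergence-free test `a` (`(f₊·∇)f₊ = ∇|f₊|²/2`). -/
def HelicalHalfTestedEuler : Prop :=
  IsSmooth tgForcePlus ∧ IsDivFree tgForcePlus ∧ HasZeroMean tgForcePlus ∧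
    (∀ x, BDSV.curl tgForcePlus x = (2 * Real.pi * Real.sqrt 3) • tgForcePlus x) ∧
    (∫ x, ⟪tgForce x, tgForcePlus x⟫_ℝ = 1 / 8) ∧ (∫ x, ‖tgForcePlus x‖ ^ 2 = 1 / 8) ∧
    ∀ a : 𝕋³ → ℝ³, IsSmooth a → IsDivFree a → ∫ x, ⟪tgForcePlus x, convect tgForcePlus a x⟫_ℝ = 0

/-- **Chiral work split** (exact identity, card A): for every admissible Galerkin steady TG state at
resolution `N ≥ 2` (test with `a := U` and `a := curl U`, both admissible; `curl f_TG = 2π√3 (f₊ − f₋)`):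
`(f₊,U) = (ν/2)(‖∇U‖² + S(U)/(2π√3))`, `(f₋,U) = (ν/2)(‖∇U‖² − S(U)/(2π√3))`, `S(U) = ∫⟪curl U, curl curl U⟫`
the superhelicity (helicity dissipation). -/
def ChiralWorkSplit : Prop :=
  ∀ (ν : ℝ) (N : ℕ) (U : 𝕋³ → ℝ³), 2 ≤ N → IsSteadyState ν N tgForce U →
    (∫ x, ⟪tgForcePlus x, U x⟫_ℝ =
        ν / 2 * (gradNormSq U + (1 / (2 * Real.pi * Real.sqrt 3)) *
          ∫ x, ⟪BDSV.curl U x, BDSV.curl (BDSV.curl U) x⟫_ℝ)) ∧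
    (∫ x, ⟪tgForceMinus x, U x⟫_ℝ =
        ν / 2 * (gradNormSq U - (1 / (2 * Real.pi * Real.sqrt 3)) *
          ∫ x, ⟪BDSV.curl U x, BDSV.curl (BDSV.curl U) x⟫_ℝ))

/-- **No Beltrami field in the mirror class** (card A, rigidity half): a smooth `K`-symmetric field with
`curl u = λ u`, `λ ≠ 0`, vanishes identically (a reflection maps `curl u = λu` to `curl u = −λu`).  Hence a
large-amplitude chiral carrier forces the state OUT of `Fix K`. -/
def NoBeltramiInMirrorClass : Prop :=
  ∀ (u : 𝕋³ → ℝ³) (lam : ℝ), IsSmooth u → IsKSymm u → lam ≠ 0 →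
    (∀ x, BDSV.curl u x = lam • u x) → ∀ x, u x = 0

/-- **Transfer target C⁺ of card A** (`ChiralLogLoud`): log-loud admissible TG states whose work is carried by
the positive-helical half with a DEFINITE work angle, `(f₊,U) ≥ θ·‖U‖₂` (θ > 0 fixed along the sequence)
— the "maximal-work / chiral-carrier" corner of the crux. -/
def ChiralLogLoud : Prop :=
  ∃ (ν : ℕ → ℝ) (E c θ : ℝ), (∀ j, 0 < ν j ∧ ν j ≤ 1 / 4) ∧ Tendsto ν atTop (𝓝 0) ∧ 0 < c ∧ 0 < θ ∧
    ∀ j, ∀ᶠ N in atTop, ∃ U : 𝕋³ → ℝ³, IsSteadyState (ν j) N tgForce U ∧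
      ∫ x, ‖U x‖ ^ 2 ≤ E * Real.log (1 / ν j) ∧ c ≤ ν j * gradNormSq U ∧
      θ * Real.sqrt (∫ x, ‖U x‖ ^ 2) ≤ ∫ x, ⟪tgForcePlus x, U x⟫_ℝ

/-- `C⁺ ⇒ crux` (drop the chirality clause; the crux's `∀ f, f = f_TG →` binder is sugar, `rfl`). -/
theorem crux_of_chiral (h : ChiralLogLoud) :
    Summit.AnomalousDissipation.AnomalousDissipation.Theses.MirrorVariety.TaylorGreenLogLoudStates := by
  rintro f rfl
  obtain ⟨ν, E, c, θ, hν, hlim, hc, -, hj⟩ := h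
  refine ⟨ν, E, c, hν, hlim, hc, fun j => ?_⟩
  refine (hj j).mono fun N hN => ?_
  obtain ⟨U, hS, hE, hloud, -⟩ := hN
  obtain ⟨hs, hdiv, hmean, hband, htest⟩ := hS
  exact ⟨U, ⟨hs, hdiv, hmean, hband, htest⟩, hE, hloud⟩

/-! ## Card B — rotation class and edge tubes -/

/-- The rotation by `π` about the `x`-axis, `(x,y,z) ↦ (x,−y,−z)` (an INTEGER matrix, proper: `det = +1`);
on `T³ = (ℝ/ℤ)³` it fixes the four lines `{y, z ∈ {0, ½}}` pointwise-setwise. -/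
def rotX : Matrix (Fin 3) (Fin 3) ℤ := Matrix.diagonal ![1, -1, -1]

/-- Equivariance under the `x`-rotation (velocity is a vector: `u(Rx) = R u(x)`). -/
def IsRxSymm (u : 𝕋³ → ℝ³) : Prop :=
  ∀ x : 𝕋³, u (Torus.mulVecT rotX x) = actVec rotX (u x)

/-- The four `x`-parallel rotation axes `{x₁, x₂ ∈ {0, ½}}` of `T³`. -/
def OnXAxis (x : 𝕋³) : Prop :=
  (x 1 = 0 ∨ x 1 = ((1 / 2 : ℝ) : UnitAddCircle)) ∧ (x 2 = 0 ∨ x 2 = ((1 / 2 : ℝ) : UnitAddCircle))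

/-- **First lemma of card B** (`AxisPinning`): in the rotation class the four `x`-lines are invariant
straight streamlines — the transverse velocity vanishes there identically (`u(Rx) = Ru(x)` with `Rx = x`
forces `u₁ = −u₁`, `u₂ = −u₂`), so a straight tube on an axis has ZERO normal drift (no self-induction
to cancel, no station-holding problem), while the axial vorticity `(curl u)₀` is even across the axis and
unconstrained along it (torus-wrapping one-signed tubes are allowed). -/
def AxisPinning : Prop :=
  ∀ u : 𝕋³ → ℝ³, IsRxSymm u → ∀ x : 𝕋³, OnXAxis x → u x 1 = 0 ∧ u x 2 = 0

/-- **Mirror edges carry no flux** (card B, the correction to the route's intended witness): in the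
mirror class `K` the tangential vorticity vanishes on every mirror plane, so on the `x`-edges (intersection
of the planes `x₁ ∈ {0,½}` and `x₂ ∈ {0,½}`) the AXIAL vorticity `(curl u)₀` vanishes too — `Fix K` admits
no vortex tube along a lattice edge; edge tubes need the rotation class. -/
def MirrorEdgesCarryNoFlux : Prop :=
  ∀ u : 𝕋³ → ℝ³, IsSmooth u → IsKSymm u → ∀ x : 𝕋³, OnXAxis x → BDSV.curl u x 0 = 0

end Summit.AnomalousDissipation.AnomalousDissipation.Cruxes.TaylorGreenLogLoudStates.SketchIdeator3

end
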